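import Mathlib
import Literature.Analysis.ODE.LinearObservability

/-!
# Duhamel's formula for a bounded generator: the mild formula (M) at the Galerkin level (instab g14, cell `ns-blowup`, 2026-08-26)

HONEST FRAMING (human ruling D-0035): nothing here is a claim about Navier–Stokes blow-up.
WHAT THIS IS NOT: not NS evidence. `EmergenceMildDuhamel` (g13) and `StabilityMildDuhamel` (g14)
make the KEEP / KILL words of a certified linear core kernel sentences CONDITIONAL on three named
analytic inputs, the first of which is (M): the MILD FORMULA
`u t − e^{tA} u₀ = ∫₀ᵗ e^{(t−s)A} N(u s) ds` for the perturbation equation `u' = A u + N(u)`.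
For the TRUE linearised operator (unbounded, `A = νℙΔ − ℙ[(U·∇)· + (·∇)U]`) this is the
«generation / mild-solution layer» (INSTAB-BRIDGE l.126 (b)(i), Lean price L). For a BOUNDED
generator `A : E →L[ℝ] E` on a Banach space — in particular for every finite-dimensional Galerkin
truncation, which is where the cell's certificates (D2, 3-L, 3-L′, PART 4/4b) are actually computed —
(M) is the classical variation-of-constants formula, and this file PROVES it (fundamental theorem of
calculus for `s ↦ e^{(t−s)A} u(s)`; Mathlib's `hasDerivAt_exp_smul_const` differentiates the
one-parameter group, the tree's `Literature.Analysis.ODE.hasDerivAt_linearFlow` the flow):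

* `hasDerivAt_exp_sub_smul`, `hasDerivAt_exp_sub_smul_apply` — `d/ds e^{(t−s)A} = −e^{(t−s)A} A`
  and `d/ds [e^{(t−s)A} u(s)] = e^{(t−s)A} (u'(s) − A u(s))`;
* `variation_of_constants` — **Duhamel**: a curve `u`, continuous on `[0, t]` with
  `u'(s) = A u(s) + F(s)` on `(0, t)` (`F` continuous on `[0, t]`), satisfies
  `u t = e^{tA} u 0 + ∫₀ᵗ e^{(t−s)A} F s ds`;
* `eq_linearFlow_of_hasDerivAt` — `F = 0`: `u t = e^{tA} u 0` (uniqueness of the linear flow by the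
  same computation, no Grönwall);
* `mild_formula_of_classical` — **(M) for bounded generators**: every classical solution of
  `u' = A u + N(u)` on `[0, T₀]` satisfies, at every `t ∈ [0, T₀]`,
  `u t − e^{tA}(u 0) = ∫₀ᵗ e^{(t−s)A} N(u s) ds` — literally hypothesis `hmild` of
  `EmergenceMildDuhamel.floor_of_mild` / `StabilityMildDuhamel.decay_of_mild` with
  `T τ = e^{τA}`, `ℓ t = e^{tA} u 0`;
* `linearFlow_eigenvector`, `norm_linearFlow_smul_eigenvector` — for a real eigenpair `A v = λ v`:
  `e^{tA} v = e^{λt} v` (`t ≥ 0`), hence `‖e^{tA}(ε v)‖ = ε e^{λt}` for `‖v‖ = 1`, `ε ≥ 0` — the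
  hypothesis `hℓ` of `floor_of_mild`;
* `hasDerivWithinAt_linearFlow` — the linear flow is a classical trajectory within any window, i.e.
  the `hu` hypothesis of `LyapunovSkewCutSemigroup.norm_le_of_generator_form` / `norm_le_of_two_level`
  (so for bounded generators the certificates give (T) for ALL initial data — assembled in
  `BoundedGeneratorEmergence`).

In print: any ODE text (Hartman 2002 Ch. IV §8; Coddington–Levinson 1955 Ch. 3 §6); folklore.
Mathlib + `Literature.Analysis.ODE.LinearObservability`; no new definitions.
-/

noncomputable section

namespace Summit.NavierStokesRegularity.FluidComputer.BoundedGeneratorDuhamel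

open Set MeasureTheory intervalIntegral Filter Topology NormedSpace
open Literature.Analysis.ODE

variable {E : Type*} [NormedAddCommGroup E] [NormedSpace ℝ E] [CompleteSpace E]

/-! ### The conjugating factor `e^{(t−s)A}` -/

/-- `d/ds e^{(t−s)A} = −(e^{(t−s)A} A)` (one-parameter group, chain rule). -/
theorem hasDerivAt_exp_sub_smul (A : E →L[ℝ] E) (t s : ℝ) :
    HasDerivAt (fun r : ℝ => exp ((t - r) • A)) (-(exp ((t - s) • A) * A)) s := by
  have h1 : HasDerivAt (fun u : ℝ => exp (u • A)) (exp ((t - s) • A) * A) (t - s) :=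
    hasDerivAt_exp_smul_const (𝕂 := ℝ) A (t - s)
  have h2 : HasDerivAt (fun r : ℝ => t - r) (-1) s := by
    simpa using (hasDerivAt_id s).const_sub t
  have h := h1.scomp s h2
  simpa [Function.comp_def] using h

/-- `s ↦ e^{(t−s)A}` is continuous. -/
theorem continuous_exp_sub_smul (A : E →L[ℝ] E) (t : ℝ) :
    Continuous fun r : ℝ => exp ((t - r) • A) :=
  continuous_iff_continuousAt.2 fun r => (hasDerivAt_exp_sub_smul A t r).continuousAt

/-- **Derivative of the conjugated curve.** If `u` has derivative `u'` at `s`, then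
`d/ds [e^{(t−s)A} u(s)] = e^{(t−s)A} (u' − A u(s))`. -/
theorem hasDerivAt_exp_sub_smul_apply (A : E →L[ℝ] E) {u : ℝ → E} {u' : E} (t : ℝ) {s : ℝ}
    (hu : HasDerivAt u u' s) :
    HasDerivAt (fun r : ℝ => exp ((t - r) • A) (u r)) (exp ((t - s) • A) (u' - A (u s))) s := by
  have h := (hasDerivAt_exp_sub_smul A t s).clm_apply hu
  refine h.congr_deriv ?_
  have e : (-(exp ((t - s) • A) * A)) (u s) = -(exp ((t - s) • A) (A (u s))) := rfl
  rw [map_sub, e]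
  abel

/-! ### Duhamel's formula -/

/-- **Variation of constants (Duhamel's formula) for a bounded generator.** Let `A : E →L[ℝ] E`,
`t ≥ 0`, `u` continuous on `[0, t]` with `u'(s) = A u(s) + F(s)` at every `s ∈ (0, t)`, and `F`
continuous on `[0, t]`. Then `u t = e^{tA} u 0 + ∫₀ᵗ e^{(t−s)A} F s ds`. -/
theorem variation_of_constants (A : E →L[ℝ] E) {u F : ℝ → E} {t : ℝ} (ht : 0 ≤ t)
    (hu : ContinuousOn u (Icc 0 t)) (hF : ContinuousOn F (Icc 0 t))
    (hderiv : ∀ s ∈ Ioo 0 t, HasDerivAt u (A (u s) + F s) s) :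
    u t = exp (t • A) (u 0) + ∫ s in (0:ℝ)..t, exp ((t - s) • A) (F s) := by
  set φ : ℝ → E := fun r => exp ((t - r) • A) (u r) with hφ
  have hφcont : ContinuousOn φ (Icc 0 t) :=
    (continuous_exp_sub_smul A t).continuousOn.clm_apply hu
  have hφder : ∀ s ∈ Ioo 0 t, HasDerivAt φ (exp ((t - s) • A) (F s)) s := by
    intro s hs
    have h := hasDerivAt_exp_sub_smul_apply A t (hderiv s hs)
    have e : A (u s) + F s - A (u s) = F s := add_sub_cancel_left _ _
    rw [e] at h
    exact h
  have hint : IntervalIntegrable (fun s => exp ((t - s) • A) (F s)) volume 0 t :=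
    ContinuousOn.intervalIntegrable_of_Icc ht
      ((continuous_exp_sub_smul A t).continuousOn.clm_apply hF)
  have hFTC := intervalIntegral.integral_eq_sub_of_hasDerivAt_of_le ht hφcont hφder hint
  have hφt : φ t = u t := by
    simp only [hφ, sub_self, zero_smul, exp_zero]
    rfl
  have hφ0 : φ 0 = exp (t • A) (u 0) := by
    simp only [hφ, sub_zero]
  rw [hFTC, hφt, hφ0]
  abel

/-- **The homogeneous case: a classical solution of `u' = A u` IS the linear flow,**
`u t = e^{tA} u 0` — uniqueness for the bounded linear equation by the Duhamel computation itself
(no Grönwall argument). -/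
theorem eq_linearFlow_of_hasDerivAt (A : E →L[ℝ] E) {u : ℝ → E} {t : ℝ} (ht : 0 ≤ t)
    (hu : ContinuousOn u (Icc 0 t)) (hderiv : ∀ s ∈ Ioo 0 t, HasDerivAt u (A (u s)) s) :
    u t = exp (t • A) (u 0) := by
  have h := variation_of_constants A (F := fun _ => (0 : E)) ht hu continuousOn_const
    (fun s hs => by simpa using hderiv s hs)
  simpa using h

/-- **(M) FOR BOUNDED GENERATORS.** Every classical solution of the perturbation equation
`u' = A u + N(u)` on `[0, T₀]` — `u` continuous on `[0, T₀]`, `s ↦ N(u s)` continuous on `[0, T₀]`,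
the equation holding at every interior point — satisfies the mild formula about the free linear
evolution of its initial value: for every `t ∈ [0, T₀]`,
`u t − e^{tA}(u 0) = ∫₀ᵗ e^{(t−s)A} N(u s) ds`. This is hypothesis `hmild` of
`EmergenceMildDuhamel.floor_of_mild` / `half_prediction_of_mild` and of
`StabilityMildDuhamel.decay_of_mild` with `T τ = e^{τA}` and `ℓ t = e^{tA}(u 0)`. -/
theorem mild_formula_of_classical (A : E →L[ℝ] E) (N : E → E) {u : ℝ → E} {T₀ : ℝ}
    (hu : ContinuousOn u (Icc 0 T₀)) (hN : ContinuousOn (fun s => N (u s)) (Icc 0 T₀))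
    (hderiv : ∀ s ∈ Ioo 0 T₀, HasDerivAt u (A (u s) + N (u s)) s) :
    ∀ t ∈ Icc 0 T₀,
      u t - exp (t • A) (u 0) = ∫ s in (0:ℝ)..t, exp ((t - s) • A) (N (u s)) := by
  intro t ht
  have hsub : Icc 0 t ⊆ Icc 0 T₀ := Icc_subset_Icc_right ht.2
  have h := variation_of_constants A (F := fun s => N (u s)) ht.1 (hu.mono hsub) (hN.mono hsub)
    (fun s hs => hderiv s ⟨hs.1, hs.2.trans_le ht.2⟩)
  rw [h]
  abel

/-! ### The linear flow on an eigenvector, and as a classical trajectory -/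

/-- **The linear flow on a real eigenvector:** `A v = λ v` gives `e^{tA} v = e^{λt} v` for `t ≥ 0`
(both sides solve `w' = A w` with the same initial value; `eq_linearFlow_of_hasDerivAt`). -/
theorem linearFlow_eigenvector (A : E →L[ℝ] E) {v : E} {lam : ℝ} (hv : A v = lam • v) {t : ℝ}
    (ht : 0 ≤ t) : exp (t • A) v = Real.exp (lam * t) • v := by
  set w : ℝ → E := fun s => Real.exp (lam * s) • v with hw
  have hwder : ∀ s : ℝ, HasDerivAt w (A (w s)) s := by
    intro s
    have h1 : HasDerivAt (fun s : ℝ => Real.exp (lam * s)) (Real.exp (lam * s) * lam) s := by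
      have h := ((hasDerivAt_id s).const_mul lam).exp
      simpa using h
    have h2 := h1.smul_const v
    refine h2.congr_deriv ?_
    simp only [hw, map_smul, hv, smul_smul]
  have hwcont : Continuous w := continuous_iff_continuousAt.2 fun s => (hwder s).continuousAt
  have h := eq_linearFlow_of_hasDerivAt A ht hwcont.continuousOn (fun s _ => hwder s)
  have hw0 : w 0 = v := by simp [hw]
  rw [hw0] at h
  rw [← h]

/-- **Norm of the linear prediction:** for a normalised real eigenvector (`A v = λ v`, `‖v‖ = 1`)
and `ε ≥ 0`, `‖e^{tA}(ε v)‖ = ε e^{λt}` (`t ≥ 0`) — hypothesis `hℓ` of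
`EmergenceMildDuhamel.floor_of_mild` for `ℓ t = e^{tA}(u 0)`, `u 0 = ε v`. -/
theorem norm_linearFlow_smul_eigenvector (A : E →L[ℝ] E) {v : E} {lam ε : ℝ} (hv : A v = lam • v)
    (hv1 : ‖v‖ = 1) (hε : 0 ≤ ε) {t : ℝ} (ht : 0 ≤ t) :
    ‖exp (t • A) (ε • v)‖ = ε * Real.exp (lam * t) := by
  rw [map_smul, linearFlow_eigenvector A hv ht, norm_smul, norm_smul, hv1, mul_one,
    Real.norm_of_nonneg hε, Real.norm_of_nonneg (Real.exp_pos _).le]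

/-- **The linear flow is a classical trajectory within every window:** `s ↦ e^{sA} x` has
derivative `A (e^{tA} x)` at `t` within any set — hypothesis `hu` of
`LyapunovSkewCutSemigroup.norm_le_of_generator_form` / `norm_le_of_two_level`. -/
theorem hasDerivWithinAt_linearFlow (A : E →L[ℝ] E) (x : E) (S : Set ℝ) (t : ℝ) :
    HasDerivWithinAt (fun s : ℝ => exp (s • A) x) (A (exp (t • A) x)) S t :=
  (hasDerivAt_linearFlow A x t).hasDerivWithinAt

omit [CompleteSpace E] in
/-- The linear flow at time `0` is the identity (re-export of
`Literature.Analysis.ODE.linearFlow_zero` in the form `exp ((0:ℝ) • A) x = x`). -/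
theorem linearFlow_zero_apply (A : E →L[ℝ] E) (x : E) : exp ((0:ℝ) • A) x = x :=
  linearFlow_zero A x

end Summit.NavierStokesRegularity.FluidComputer.BoundedGeneratorDuhamel

end
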